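import Mathlib
import HarnessLib
import Summits.Ventures.LatticeQCDFlow.Scoring.ChainTimeAverage

/-!
# The EXACT second moment of a block sum of the stationary chain:
# `E_π[(Σ_{t<n} f̄(X_{s+t}))²] = n σ²_f − 2 Γ_f + 2 Σ_{j≥0} (j+1) γ_{j+n+1}` with `Γ_f = Σ_{k≥1} k γ_k`,
# and the series bookkeeping under a geometric bound `|γ_k| ≤ K ρ^k`

HONEST FRAMING: exact (Metropolis-corrected) sampling algorithms for lattice gauge theory;
figures of merit are autocorrelation/cost numbers at stated couplings and volumes; no
continuum-physics claim.

Venture `LatticeQCDFlow` (cell pub-lqcd), topic `Scoring`; FANOUT row 8 (`s0-cpn-nemc`, GEN-21).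
NEW WORK of the cell, not a published result; no definition is introduced; nothing is cited as a
fact.  `Scoring/GeometricEnvelopeBlockSumSharp.lean` proved `|E_{μ₀}[S_{s,n}²] − n σ²_f| = O(1)`
uniformly and left the leading constant of that `O(1)` as NOT CLAIMED.  This file supplies the
ALGEBRA that identifies it; `Scoring/GeometricEnvelopeBlockSumLeadingBias.lean` adds the transient
from an arbitrary start under the envelope.  Write `γ_k = autocov κ π f̄ k` (`f̄ = f − πf`),
`σ²_f = γ₀ + 2 Σ_{k≥1} γ_k` and `Γ_f = Σ_{k≥1} k γ_k = Σ' k, (k+1) γ_{k+1}`.  The stationary double sum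
is `Σ_{t,t'<n} γ_{|t−t'|} = n σ²_f − 2 Γ_f + 2 Σ' j, (j+1) γ_{j+n+1}` EXACTLY whenever the two series
converge (pair count `Scoring/VarianceOfTheMean.sum_sum_dist` and two series splits at `n`); under
a geometric bound `|γ_k| ≤ K ρ^k` (`0 ≤ ρ < 1`) they do, and the last series is
`≤ K ρ^{n+1}/(1−ρ)²` in absolute value, `|Γ_f| ≤ K ρ/(1−ρ)²`.  For the chain started in `π` the pair
expectations ARE the `γ`'s (`Scoring/ChainTimeAverage.chain_autocov`), so the formula is the exact
second moment of every block sum of the stationary chain.  Printed counterpart NAMED ONLY: the bias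
expansion of non-overlapping batch means `E[V̂_BM] = σ² + γ₁ (a+1)/(ab) + o(1/b)`, `γ₁ = −2 Σ_k k γ_k`
(Goldsman–Meketon 1986; Song–Schmeiser 1995; Chien–Goldsman–Melamed 1997; Flegal–Jones 2010 §2),
nothing cited as a fact.

## Content (`|γ_k| ≤ K ρ^k` with `0 ≤ ρ < 1` for the bounds; `π` invariant, `|f| ≤ C` measurable)

* `summable_of_abs_le_geometric`, `summable_succ_mul_of_abs_le_geometric`,
  `abs_tsum_succ_mul_shift_le_of_abs_le_geometric` (`|Σ' j, (j+1) γ_{j+n+1}| ≤ K ρ^{n+1}/(1−ρ)²`),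
  `abs_tsum_succ_mul_le_of_abs_le_geometric` (`|Σ' k, (k+1) γ_{k+1}| ≤ K ρ/(1−ρ)²`);
* **`sum_sum_dist_eq_leading`** — for ANY `γ` with `Σ γ_{k+1}`, `Σ (k+1) γ_{k+1}` summable:
  `Σ_{t<n} Σ_{t'<n} γ_{|t−t'|} = n (γ₀ + 2 Σ' γ_{k+1}) − 2 Σ' (k+1) γ_{k+1} + 2 Σ' j, (j+1) γ_{j+n+1}`;
* **`chain_blockSum_sq_eq_leading_of_invariant`** — started in `π` (only the two summabilities):
  `E_π[(Σ_{t<n} f̄(X_{s+t}))²] = n σ²_f − 2 Γ_f + 2 Σ' j, (j+1) γ_{j+n+1}` for every `s`, `n`.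

NOT CLAIMED: the sign of `Γ_f` for a given sampler (it is `> 0` for positively autocorrelated chains,
where the squared block sum UNDER-estimates `n σ²_f`); unbounded observables; any number of ours.
-/

noncomputable section

namespace Summit.Ventures.LatticeQCDFlow.Scoring

open MeasureTheory ProbabilityTheory Filter Finset Preorder
open scoped ENNReal Topology

/-! ### Series under a geometric bound -/

section Series

variable {γ : ℕ → ℝ} {K ρ : ℝ}

/-- `|γ_k| ≤ K ρ^k` with `0 ≤ ρ < 1` ⇒ every shifted tail `j ↦ γ_{j+m}` is summable. -/
theorem summable_of_abs_le_geometric (hρ0 : 0 ≤ ρ) (hρ1 : ρ < 1) (hγ : ∀ k, |γ k| ≤ K * ρ ^ k)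
    (m : ℕ) : Summable fun j : ℕ => γ (j + m) :=
  Summable.of_norm_bounded ((summable_geometric_of_lt_one hρ0 hρ1).mul_left (K * ρ ^ m))
    fun j => by
      rw [Real.norm_eq_abs]
      refine (hγ (j + m)).trans (le_of_eq ?_)
      rw [pow_add]; ring

/-- `|γ_k| ≤ K ρ^k` with `0 ≤ ρ < 1` ⇒ `j ↦ (j+1) γ_{j+m+1}` is summable for every shift `m`
(comparison with `Σ (j+1) ρ^{j+1}`). -/
theorem summable_succ_mul_of_abs_le_geometric (hρ0 : 0 ≤ ρ) (hρ1 : ρ < 1)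
    (hγ : ∀ k, |γ k| ≤ K * ρ ^ k) (m : ℕ) :
    Summable fun j : ℕ => ((j : ℝ) + 1) * γ (j + m + 1) := by
  have hnorm : ‖ρ‖ < 1 := by rw [Real.norm_eq_abs, abs_of_nonneg hρ0]; exact hρ1
  have hser : Summable fun j : ℕ => (j : ℝ) * ρ ^ j :=
    (hasSum_coe_mul_geometric_of_norm_lt_one hnorm).summable
  have hser1 : Summable fun j : ℕ => (((j + 1 : ℕ) : ℝ)) * ρ ^ (j + 1) :=
    (summable_nat_add_iff 1).2 hser
  refine Summable.of_norm_bounded (hser1.mul_left (|K| * ρ ^ m)) fun j => ?_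
  rw [Real.norm_eq_abs, abs_mul, abs_of_nonneg (by positivity : (0 : ℝ) ≤ (j : ℝ) + 1)]
  have hK : K * ρ ^ (j + m + 1) ≤ |K| * ρ ^ (j + m + 1) :=
    mul_le_mul_of_nonneg_right (le_abs_self K) (pow_nonneg hρ0 _)
  calc ((j : ℝ) + 1) * |γ (j + m + 1)| ≤ ((j : ℝ) + 1) * (|K| * ρ ^ (j + m + 1)) :=
        mul_le_mul_of_nonneg_left ((hγ _).trans hK) (by positivity)
    _ = |K| * ρ ^ m * ((((j + 1 : ℕ) : ℝ)) * ρ ^ (j + 1)) := by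
        push_cast
        rw [show j + m + 1 = m + (j + 1) by omega, pow_add]
        ring

/-- **The weighted tail is geometrically small**: `|γ_k| ≤ K ρ^k` (`0 ≤ ρ < 1`) ⇒
`|Σ' j, (j+1) γ_{j+n+1}| ≤ K ρ^{n+1}/(1−ρ)²` (since `Σ' j, (j+1) ρ^{j+1} = ρ/(1−ρ)²`). -/
theorem abs_tsum_succ_mul_shift_le_of_abs_le_geometric (hρ0 : 0 ≤ ρ) (hρ1 : ρ < 1)
    (hγ : ∀ k, |γ k| ≤ K * ρ ^ k) (n : ℕ) :
    |∑' j : ℕ, ((j : ℝ) + 1) * γ (j + n + 1)| ≤ K * ρ ^ (n + 1) / (1 - ρ) ^ 2 := by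
  have hnorm : ‖ρ‖ < 1 := by rw [Real.norm_eq_abs, abs_of_nonneg hρ0]; exact hρ1
  have hser := hasSum_coe_mul_geometric_of_norm_lt_one hnorm
  -- `Σ' j, (j+1) ρ^{j+1} = ρ/(1−ρ)²` (the `j = 0` term of `Σ j ρ^j` vanishes)
  have hser1 : HasSum (fun j : ℕ => (((j + 1 : ℕ) : ℝ)) * ρ ^ (j + 1)) (ρ / (1 - ρ) ^ 2) := by
    have h := (hasSum_nat_add_iff' 1).2 hser
    simp only [Finset.sum_range_one, Nat.cast_zero, zero_mul, sub_zero] at h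
    exact h
  have hmaj : HasSum (fun j : ℕ => K * ρ ^ n * ((((j + 1 : ℕ) : ℝ)) * ρ ^ (j + 1)))
      (K * ρ ^ n * (ρ / (1 - ρ) ^ 2)) := hser1.mul_left _
  have hs := summable_succ_mul_of_abs_le_geometric hρ0 hρ1 hγ n
  calc |∑' j : ℕ, ((j : ℝ) + 1) * γ (j + n + 1)| = ‖∑' j : ℕ, ((j : ℝ) + 1) * γ (j + n + 1)‖ :=
        (Real.norm_eq_abs _).symm
    _ ≤ ∑' j : ℕ, ‖((j : ℝ) + 1) * γ (j + n + 1)‖ := norm_tsum_le_tsum_norm hs.norm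
    _ ≤ ∑' j : ℕ, K * ρ ^ n * ((((j + 1 : ℕ) : ℝ)) * ρ ^ (j + 1)) := by
        refine Summable.tsum_le_tsum (fun j => ?_) hs.norm hmaj.summable
        rw [Real.norm_eq_abs, abs_mul, abs_of_nonneg (by positivity : (0 : ℝ) ≤ (j : ℝ) + 1)]
        calc ((j : ℝ) + 1) * |γ (j + n + 1)| ≤ ((j : ℝ) + 1) * (K * ρ ^ (j + n + 1)) :=
              mul_le_mul_of_nonneg_left (hγ _) (by positivity)
          _ = K * ρ ^ n * ((((j + 1 : ℕ) : ℝ)) * ρ ^ (j + 1)) := by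
              push_cast
              rw [show j + n + 1 = n + (j + 1) by omega, pow_add]
              ring
    _ = K * ρ ^ n * (ρ / (1 - ρ) ^ 2) := hmaj.tsum_eq
    _ = K * ρ ^ (n + 1) / (1 - ρ) ^ 2 := by rw [pow_succ]; ring

/-- **THE STATIONARY DOUBLE SUM, EXACTLY.**  For any `γ : ℕ → ℝ` with `Σ γ_{k+1}` and
`Σ (k+1) γ_{k+1}` summable and every `n`:
`Σ_{t<n} Σ_{t'<n} γ_{|t−t'|} = n (γ₀ + 2 Σ' k, γ_{k+1}) − 2 Σ' k, (k+1) γ_{k+1} + 2 Σ' j, (j+1) γ_{j+n+1}`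
— `n σ²`, minus twice the first moment of the autocovariances, plus a tail that vanishes as `n → ∞`. -/
theorem sum_sum_dist_eq_leading (hs : Summable fun k : ℕ => γ (k + 1))
    (hs' : Summable fun k : ℕ => ((k : ℝ) + 1) * γ (k + 1)) (n : ℕ) :
    ∑ t ∈ Finset.range n, ∑ t' ∈ Finset.range n, γ (Nat.dist t t')
      = n * (γ 0 + 2 * ∑' k, γ (k + 1)) - 2 * ∑' k : ℕ, ((k : ℝ) + 1) * γ (k + 1)
        + 2 * ∑' j : ℕ, ((j : ℝ) + 1) * γ (j + n + 1) := by
  rw [sum_sum_dist γ n]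
  -- split both series at `n`
  have h1 : ∑' k, γ (k + 1) = ∑ k ∈ Finset.range n, γ (k + 1) + ∑' j, γ (j + n + 1) := by
    rw [← hs.sum_add_tsum_nat_add n]
  have hs'' : Summable fun j : ℕ => (((j + n : ℕ) : ℝ) + 1) * γ (j + n + 1) :=
    (summable_nat_add_iff (f := fun k : ℕ => ((k : ℝ) + 1) * γ (k + 1)) n).2 hs'
  have h2 : ∑' k : ℕ, ((k : ℝ) + 1) * γ (k + 1)
      = ∑ k ∈ Finset.range n, ((k : ℝ) + 1) * γ (k + 1)
        + ∑' j, (((j + n : ℕ) : ℝ) + 1) * γ (j + n + 1) := by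
    rw [← hs'.sum_add_tsum_nat_add n]
  have htail : Summable fun j : ℕ => γ (j + n + 1) := (summable_nat_add_iff (f := fun k : ℕ =>
    γ (k + 1)) n).2 hs
  -- `Σ' (j+n+1) γ_{j+n+1} = Σ' (j+1) γ_{j+n+1} + n Σ' γ_{j+n+1}`
  have hsJ : Summable fun j : ℕ => ((j : ℝ) + 1) * γ (j + n + 1) := by
    have h := hs''.sub (htail.mul_left (n : ℝ))
    refine h.congr fun j => ?_
    push_cast; ring
  have h3 : ∑' j, (((j + n : ℕ) : ℝ) + 1) * γ (j + n + 1)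
      = ∑' j : ℕ, ((j : ℝ) + 1) * γ (j + n + 1) + n * ∑' j, γ (j + n + 1) := by
    rw [← tsum_mul_left, ← hsJ.tsum_add (htail.mul_left (n : ℝ))]
    exact tsum_congr fun j => by push_cast; ring
  rw [h1, h2, h3]
  have e1 : ∑ t ∈ Finset.range n, ((n : ℝ) - (t + 1)) * γ (t + 1)
      = (n : ℝ) * ∑ t ∈ Finset.range n, γ (t + 1)
        - ∑ t ∈ Finset.range n, ((t : ℝ) + 1) * γ (t + 1) := by
    rw [Finset.mul_sum, ← Finset.sum_sub_distrib]
    exact Finset.sum_congr rfl fun t _ => by ring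
  rw [e1]
  ring

/-- `|Σ' k, (k+1) γ_{k+1}| ≤ K ρ/(1−ρ)²` (the `n = 0` case of the tail bound): the leading bias
constant is finite and explicitly bounded under a geometric bound on the autocovariances. -/
theorem abs_tsum_succ_mul_le_of_abs_le_geometric (hρ0 : 0 ≤ ρ) (hρ1 : ρ < 1)
    (hγ : ∀ k, |γ k| ≤ K * ρ ^ k) :
    |∑' k : ℕ, ((k : ℝ) + 1) * γ (k + 1)| ≤ K * ρ / (1 - ρ) ^ 2 := by
  have h := abs_tsum_succ_mul_shift_le_of_abs_le_geometric hρ0 hρ1 hγ 0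
  simp only [zero_add, pow_one] at h
  exact h

end Series

variable {Ω : Type*} [MeasurableSpace Ω]

/-! ### The stationary chain: the formula holds with equality -/

section Stationary

variable {κ : Kernel Ω Ω} [IsMarkovKernel κ] {π : Measure Ω} [IsProbabilityMeasure π]

/-- **STARTED IN `π`, EXACTLY.**  `π` invariant, `|f| ≤ C` measurable, `f̄ = f − πf`,
`γ_k = ∫ f̄ (kop κ)^[k] f̄ dπ` with `Σ γ_{k+1}` and `Σ (k+1) γ_{k+1}` summable (e.g. under any geometric
envelope); for every `s`, `n`:
`E_π[(Σ_{t<n} f̄(X_{s+t}))²] = n σ²_f − 2 Σ' k, (k+1) γ_{k+1} + 2 Σ' j, (j+1) γ_{j+n+1}`. -/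
theorem chain_blockSum_sq_eq_leading_of_invariant (hπ : Kernel.Invariant κ π)
    {f : Ω → ℝ} (hf : Measurable f) {C : ℝ} (hC : ∀ x, |f x| ≤ C)
    (hs : Summable fun k : ℕ =>
      ∫ y, (f y - ∫ z, f z ∂π) * (kop κ)^[k + 1] (fun y => f y - ∫ z, f z ∂π) y ∂π)
    (hs' : Summable fun k : ℕ => ((k : ℝ) + 1)
      * ∫ y, (f y - ∫ z, f z ∂π) * (kop κ)^[k + 1] (fun y => f y - ∫ z, f z ∂π) y ∂π) (s n : ℕ) :
    ∫ x, (∑ t ∈ Finset.range n, (f (x (s + t)) - ∫ z, f z ∂π)) ^ 2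
        ∂(Kernel.trajMeasure (X := fun _ : ℕ => Ω) π
          (fun n : ℕ => κ.comap (fun h : (i : ↥(Finset.Iic n)) → Ω => h ⟨n, Finset.mem_Iic.2 le_rfl⟩)
            (measurable_pi_apply _)))
      = n * ((∫ y, (f y - ∫ z, f z ∂π) ^ 2 ∂π)
          + 2 * ∑' k, ∫ y, (f y - ∫ z, f z ∂π) * (kop κ)^[k + 1] (fun y => f y - ∫ z, f z ∂π) y ∂π)
        - 2 * ∑' k : ℕ, ((k : ℝ) + 1)
          * ∫ y, (f y - ∫ z, f z ∂π) * (kop κ)^[k + 1] (fun y => f y - ∫ z, f z ∂π) y ∂π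
        + 2 * ∑' j : ℕ, ((j : ℝ) + 1)
          * ∫ y, (f y - ∫ z, f z ∂π) * (kop κ)^[j + n + 1] (fun y => f y - ∫ z, f z ∂π) y ∂π := by
  set P := Kernel.trajMeasure (X := fun _ : ℕ => Ω) π
      (fun n : ℕ => κ.comap (fun h : (i : ↥(Finset.Iic n)) → Ω => h ⟨n, Finset.mem_Iic.2 le_rfl⟩)
        (measurable_pi_apply _)) with hP
  set c := ∫ z, f z ∂π with hc
  have hfb : Measurable fun y => f y - c := hf.sub measurable_const
  have hCfb : ∀ y, |f y - c| ≤ C + |c| := fun y => (abs_sub _ _).trans (add_le_add (hC y) le_rfl)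
  have hC0 : 0 ≤ C + |c| := (abs_nonneg _).trans (hCfb (Classical.choice (nonempty_of_isProbabilityMeasure π)))
  set γ : ℕ → ℝ := fun k => autocov κ π (fun z => f z - c) k with hγdef
  have hσ : (∫ y, (f y - c) ^ 2 ∂π)
      + 2 * ∑' k, ∫ y, (f y - c) * (kop κ)^[k + 1] (fun y => f y - c) y ∂π
      = γ 0 + 2 * ∑' k, γ (k + 1) := by
    show _ = autocov κ π (fun z => f z - c) 0 + 2 * ∑' k, autocov κ π (fun z => f z - c) (k + 1)
    rw [autocov_zero]
    rfl
  have hΓ : ∑' k : ℕ, ((k : ℝ) + 1) * ∫ y, (f y - c) * (kop κ)^[k + 1] (fun y => f y - c) y ∂π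
      = ∑' k : ℕ, ((k : ℝ) + 1) * γ (k + 1) := rfl
  have hT : ∑' j : ℕ, ((j : ℝ) + 1) * ∫ y, (f y - c) * (kop κ)^[j + n + 1] (fun y => f y - c) y ∂π
      = ∑' j : ℕ, ((j : ℝ) + 1) * γ (j + n + 1) := rfl
  rw [hσ, hΓ, hT]
  -- expand the square; each pair IS `γ_{|t−t'|}`
  set a : ℕ → (ℕ → Ω) → ℝ := fun t x => f (x (s + t)) - c with ha
  have ham : ∀ t, Measurable (a t) := fun t => hfb.comp (measurable_pi_apply _)
  have hab : ∀ t x, |a t x| ≤ C + |c| := fun t x => hCfb _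
  have hiaa : ∀ t t', Integrable (fun x => a t x * a t' x) P := fun t t' =>
    integrable_of_bounded P ((ham t).mul (ham t')) (C := (C + |c|) * (C + |c|)) fun x => by
      rw [abs_mul]; exact mul_le_mul (hab t x) (hab t' x) (abs_nonneg _) hC0
  have hsq : ∀ x : ℕ → Ω, (∑ t ∈ Finset.range n, a t x) ^ 2
      = ∑ t ∈ Finset.range n, ∑ t' ∈ Finset.range n, a t x * a t' x := fun x => by
    rw [sq, Finset.sum_mul_sum]
  have hpair : ∀ t t', ∫ x, a t x * a t' x ∂P = γ (Nat.dist t t') := by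
    intro t t'
    rcases le_total t t' with htt' | ht't
    · obtain ⟨k, rfl⟩ := Nat.exists_eq_add_of_le htt'
      rw [Nat.dist_eq_sub_of_le htt', Nat.add_sub_cancel_left]
      have e : s + (t + k) = s + t + k := by omega
      simp only [ha]
      rw [e]
      exact chain_autocov hπ hfb hCfb (s + t) k
    · obtain ⟨k, rfl⟩ := Nat.exists_eq_add_of_le ht't
      rw [Nat.dist_eq_sub_of_le_right ht't, Nat.add_sub_cancel_left]
      have e : s + (t' + k) = s + t' + k := by omega
      have hsym : ∫ x, a (t' + k) x * a t' x ∂P = ∫ x, a t' x * a (t' + k) x ∂P :=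
        integral_congr_ae (ae_of_all _ fun x => mul_comm _ _)
      rw [hsym]
      simp only [ha]
      rw [e]
      exact chain_autocov hπ hfb hCfb (s + t') k
  have hE : ∫ x, (∑ t ∈ Finset.range n, a t x) ^ 2 ∂P
      = ∑ t ∈ Finset.range n, ∑ t' ∈ Finset.range n, γ (Nat.dist t t') := by
    rw [integral_congr_ae (ae_of_all _ hsq), integral_finsetSum _ fun t _ =>
      integrable_finsetSum _ fun t' _ => hiaa t t']
    refine Finset.sum_congr rfl fun t _ => ?_
    rw [integral_finsetSum _ fun t' _ => hiaa t t']
    exact Finset.sum_congr rfl fun t' _ => hpair t t'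
  have hsγ : Summable fun k : ℕ => γ (k + 1) := hs
  have hsγ' : Summable fun k : ℕ => ((k : ℝ) + 1) * γ (k + 1) := hs'
  show ∫ x, (∑ t ∈ Finset.range n, a t x) ^ 2 ∂P = _
  rw [hE]
  exact sum_sum_dist_eq_leading hsγ hsγ' n

end Stationary

end Summit.Ventures.LatticeQCDFlow.Scoring

end
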